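import Mathlib.LinearAlgebra.Matrix.Determinant.Basic
import Mathlib.Tactic.FieldSimp
import Mathlib.Tactic.LinearCombination
import Literature.NumberTheory.EllipticCurves.PAdicHeights
import HarnessLib

/-!
# Barrier (BirchSwinnertonDyer): the weight height is minus one half of the cyclotomic height — the second `p`-adic variable sees the rank only through the same heights

Barrier catalogue `Literature/Barriers/BirchSwinnertonDyer/` (D-0021), entry for the technique
class **"second `p`-adic variable": orders of vanishing of the Mazur–Kitagawa two-variable
`p`-adic `L`-function `L_p(f_∞; k, s)` of the Hida family through `f_E` along the weight line
`s = 1`, the central critical line `s = k/2`, a slanted line through `(k, s) = (2, 1)`, or its total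
`(k, s)`-jet at `(2, 1)`**, at an ordinary prime `p` — in the hope of avoiding the non-degeneracy
of the cyclotomic `p`-adic height that the one-variable route needs (catalogue entries
`PAdicHeightBarrier`, `ExceptionalZero`; tree `WeierstrassCurve.SchneiderConjecture`).

**The printed wall.** Venerucci (Invent. Math. 203 (2016), §4.3; `Venerucci2015`) attaches to an
elliptic curve `A/ℚ` with split multiplicative reduction at `p > 3` (and `A[p]` irreducible)
Nekovář's cyclotomic *height–weight pairing*
`⟨-,-⟩~ : H̃¹_f(ℚ, V_p A) ⊗ H̃¹_f(ℚ, V_p A) → 𝒥/𝒥²`, `𝒥 ⊂ 𝒜` the ideal of two-variable functions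
vanishing at `(k, s) = (2, 1)`, and writes (§1.2, §4.3.3)
`⟨-,-⟩~ = ⟨-,-⟩^cyc_p · {s - 1} + ⟨-,-⟩^wt_p · {k - 2}` with `⟨-,-⟩^cyc_p` restricted to the
Bloch–Kato Selmer group `H¹_f(ℚ, V_p A)` equal to Nekovář's canonical cyclotomic `p`-adic height
and the *weight pairing* `⟨-,-⟩^wt_p` "intrinsically associated with Hida's `p`-ordinary
deformation of `T_p(A)`". **Theorem 4.2** (ibid., p. 19 of arXiv:1407.1913): "The `ℚ_p`-bilinear
form `⟨-,-⟩~` enjoys the following properties. 1. (Cyclotomic specialisation) For every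
`x, y ∈ H¹_f(ℚ, V_p(A))`: `d/ds (⟨x,y⟩~(2,s))_{s=1} = ⟨x,y⟩^cyc_p`. 2. (Exceptional zero formulae)
For every `z ∈ H¹_f(ℚ, V_p(A))`: `⟨q_A,q_A⟩~ = log_p(q_A) · {s - k/2}`;
`⟨q_A,z⟩~ = log_A(res_p(z)) · {s - 1}`. 3. (Functional equation) For every
`x, y ∈ H̃¹_f(ℚ, V_p(A))`: `⟨y,x⟩~(k,s) = -⟨x,y⟩~(k,k-s)`. Proof. Part 1 is proved in [Ne]
(= Nekovář, *Selmer complexes*, Astérisque 310). Part 2 and Part 3 are proved in [Ven]." And in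
the proof of Theorem E (§6.6): "it remains to show that `2⟨P,P⟩^wt_p = -⟨P,P⟩^cyc_p`. This
follows from Theorem 4.2 (3)"; in §6.1: "By the functional equation … `⟨-,-⟩~(k,k/2)` is a
skew-symmetric pairing on `H̃¹_f(ℚ,V_p(A))`", whence
`h̃^cc_p(x) = ½ log²_A(res_p(x))` for every Selmer class `x` (eq. (ccpairing)). On the analytic
side (§2.4): `Λ_p(f_∞,k,s) = -sign(A/ℚ) · Λ_p(f_∞,k,k-s)` (Greenberg–Stevens, Thm. 5.15), "the
central critical line `s = k/2` is the 'centre of symmetry' of the functional equation", and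
`L_p(f_∞,k,1) = (1 - a_p(k)⁻¹) · L_p^*(f_∞,k)`; Theorem E (analytic rank one, `sign = -1`, (Loc)):
`-ℓ₄ · ⟨P,P⟩^cyc_p = d/dk L_p^*(f_∞,k)_{k=2} = 2ℓ₄ · ⟨P,P⟩^wt_p`, `ℓ₄ ∈ ℚ^*`; Theorem D:
`d²/ds² L_p(A/ℚ,s)_{s=1} = ℓ₃ · 𝓛_p(A) · ⟨P,P⟩^Sch_p` and "it is not known that the Schneider
height is non-zero when `L(A/ℚ,s)` has a simple zero at `s = 1`"; Theorem C: `L_p(f_∞,k,s) mod 𝒥³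
= ℓ₂ · h̃_p(P)` and `L_p(f_∞,k,s) ∈ 𝒥³` iff `P = 0`; Theorem 2.1 (Bertolini–Darmon 2007, with
Mok): `d²/dk² L_p^cc(f_∞,k)_{k=2} = ℓ · log²_A(P)`, `P ≠ 0` iff `ord_{s=1} L(A/ℚ,s) = 1`.

**What this file PROVES** (pure bilinear algebra on an explicit technique class, as for the
sibling entry `AnticyclotomicHeightDegeneracy`; no new unproved fact, D-0026):
* `hwPairing hc hw x y k s = hc x y * (s - 1) + hw x y * (k - 2)` — the value at `(k, s)` of a
  pairing of the printed shape, for ANY two bi-additive pairings `hc`, `hw` on an abelian group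
  with values in a commutative ring — and `HWFunctionalEquation hc hw`: Venerucci's Theorem 4.2
  (3), `⟨y,x⟩~(k,s) = -⟨x,y⟩~(k,k-s)` for all `x y k s` (the technique class);
* `hwFunctionalEquation_iff`: the functional equation is EQUIVALENT to "`hc` is symmetric and
  `hw x y + hw y x = -hc x y`" — i.e. `hw = -½ hc + A` with `A` alternating, and NOTHING MORE
  (the alternating part `A` is unconstrained by Theorem 4.2 (3));
* consequences: `2 · hw x x = -hc x x` (`HWFunctionalEquation.two_mul_wt_self`; Venerucci §6.6);
  skew-symmetry on the central critical line `2s = k` (`central_skew`; Venerucci §6.1); along the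
  line `k = 2 + u t, s = 1 + v t` the pairing is `t · (v · hc + u · hw)` (`hwPairing_line`) with
  `2 (v · hc x x + u · hw x x) = (2v - u) · hc x x` (`two_mul_line_self`): for a single class the
  leading coefficient along EVERY line is a fixed multiple of the cyclotomic height, the multiple
  vanishing exactly on the central critical line `u = 2v`;
* Gram matrices along a line (`lineGram`): `G(u,v)ᵀ = -G(u,u-v)` (`lineGram_transpose`), hence the
  reflection law `det G(u,v) = (-1)^r det G(u,u-v)` (`det_lineGram_reflect`, the height-side shadow
  of `Λ_p(k,s) = ∓Λ_p(k,k-s)`), `2 det G = 0` on the central line in odd rank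
  (`two_mul_det_lineGram_central`), and in rank two the explicit form
  `4 det G(u,v) = (2v - u)² det(hc) + u² (hw₀₁ - hw₁₀)²` (`four_mul_det_lineGram_fin_two`):
  Schneider-type regulator of `hc` plus the square of the Pfaffian of the alternating part;
* the extended `2 × 2` determinant on the central critical line given Theorem 4.2 (2)-type data
  `⟨q,x⟩~ = ℓ · {s-1}`: `4 (⟨q,q⟩~⟨x,x⟩~ - ⟨q,x⟩~⟨x,q⟩~) = ℓ² (k-2)²` (`extendedDet_central`;
  Venerucci eq. (ccpairing): `h̃^cc_p(x) = ½ log²_A(res_p x)`);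
* on the tree's objects: the hypothesis structure `WeightHeightData W p` (a `PAdicHeightData W p` —
  the cyclotomic height datum of the tree — plus a weight pairing `wt` subject to the functional
  equation), its API, and the barrier `Prop` `WeightHeightMinusHalfCyclotomic`, PROVED
  (`weightHeightMinusHalfCyclotomic_holds`).

## References (read for this entry; locators as printed)

* R. Venerucci, *Exceptional zero formulae and a conjecture of Perrin-Riou*, Invent. Math. 203
  (2016) 923–972 = arXiv:1407.1913 (`Venerucci2015`; held, chunks p0003–p0006, p0009, p0017–p0019,
  p0025–p0027): §1 (standing hypotheses: conductor `Np`, `p > 3` split multiplicative, `A_p`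
  irreducible), §1.2 (decomposition of `⟨-,-⟩~`, extended height-weight `h̃_p`, Thms. C, D, E and
  the remark after Thm. D), §1.3 eq. (height s=k/2), §2.4 (functional equation of `L_p(f_∞,k,s)`,
  Thm. 5.15 of [G-S]; improved `p`-adic `L`-function), §2.5 Thm. 2.1 (Bertolini–Darmon), §4.2
  (`H̃¹_f = ℚ_p · q_A ⊕ H¹_f`), §4.3 (definition of `⟨-,-⟩~`; `⟨-,-⟩~(F(k,s)) := F ∘ ⟨-,-⟩~`),
  §4.3.3 Thm. 4.2, §6.1 eq. (ccpairing), §6.5–6.6 (proofs of Thms. D, E).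
* J. Nekovář, *Selmer complexes*, Astérisque 310 (2006), §11 (`Nekovar2006`; HELD — lit store
  `paper:url-df540616d9db` (Numdam open-access scan; PDF page = book page + 9; Thm. 11.7.11 "formula
  of the Birch and Swinnerton-Dyer type" on p. 405); here cited only through Venerucci's attribution
  of Thm. 4.2 (1) and of the formalism of §4 — no statement of this file rests on a reading of it).
* J. Nekovář, *On `p`-adic height pairings*, Sém. Théorie des Nombres Paris 1990–91, Progr. Math.
  108 (1993), §7 (`Nekovar1993`; the canonical height `h^can`, as cited by Venerucci §4.3.3).
* M. Bertolini, H. Darmon, *Hida families and rational points on elliptic curves*, Invent. Math.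
  168 (2007) (`BertoliniDarmon2007`; NOT held, acq-06293 — cited through Venerucci's Thm. 2.1).
* R. Greenberg, G. Stevens, Invent. Math. 111 (1993) (`GreenbergStevens1993`; functional equation
  Thm. 5.15 and the improved `p`-adic `L`-function, as cited by Venerucci §2.4).
* D. Delbourgo, *Elliptic Curves and Big Galois Representations*, LMS LN 356 (2008)
  (`Delbourgo2008`; held): §9.3 (the `p`-adic weight pairing `⟨-,-⟩^wt_{F,p}` by bi-extensions,
  Def. 9.10) and Thm. 9.18 (weight-variable Euler characteristic: `order_{w=2} ≥ rank + 1` if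
  `⟨-,-⟩^wt_{F,p}` is degenerate on `E(F) × E(F)`, `= rank` with leading term `∝ det ⟨-,-⟩^wt`
  if it is non-degenerate and `Ш[p^∞]` is finite).
* B. Mazur, W. Stein, J. Tate, Doc. Math. Extra Vol. Coates (2006), Conj. 1.1 (`MazurSteinTate2006`):
  non-degeneracy of the cyclotomic height is conjectural (tree `SchneiderConjecture`).
-/

noncomputable section

open scoped Classical

open WeierstrassCurve

namespace Literature.Barriers.BirchSwinnertonDyer

/-! ### The technique class: two-variable height–weight pairings and their functional equation -/

section Algebra

variable {M R : Type*} [AddCommGroup M] [CommRing R]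

/-- **Value at `(k, s)` of a height–weight pairing** built from a "cyclotomic" pairing `hc` and a
"weight" pairing `hw` (bi-additive, values in a commutative ring `R`):
`⟨x,y⟩~(k,s) = hc x y · (s - 1) + hw x y · (k - 2)` — the printed decomposition
`⟨-,-⟩~ = ⟨-,-⟩^cyc_p · {s-1} + ⟨-,-⟩^wt_p · {k-2}` of Nekovář's pairing with values in
`𝒥/𝒥² = ℚ_p{s-1} ⊕ ℚ_p{k-2}`, an element `a{s-1} + b{k-2}` being recorded as the function
`(k,s) ↦ a(s-1) + b(k-2)` (so that Venerucci's convention `⟨-,-⟩~(F(k,s)) := F ∘ ⟨-,-⟩~` for an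
algebra map `F` preserving `𝒥`, e.g. `F(k,s) = (k,k-s)`, is literal substitution).
[cite: Venerucci2015, §1.2 (decomposition of ⟨-,-⟩~) and §4.3 (⟨-,-⟩~(F(k,s)) := F ∘ ⟨-,-⟩~)] -/
def hwPairing (hc hw : M →+ M →+ R) (x y : M) (k s : R) : R :=
  hc x y * (s - 1) + hw x y * (k - 2)

/-- Unfolding of `hwPairing`. [cite: Venerucci2015, §1.2] -/
theorem hwPairing_apply (hc hw : M →+ M →+ R) (x y : M) (k s : R) :
    hwPairing hc hw x y k s = hc x y * (s - 1) + hw x y * (k - 2) := rfl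

/-- **Cyclotomic specialisation** (shape of Venerucci's Thm. 4.2 (1)): on the cyclotomic line
`k = 2` the pairing is `hc x y · (s - 1)`, so `d/ds ⟨x,y⟩~(2,s)|_{s=1} = hc x y`.
[cite: Venerucci2015, §4.3.3 Thm. 4.2 (1)] -/
theorem hwPairing_two_left (hc hw : M →+ M →+ R) (x y : M) (s : R) :
    hwPairing hc hw x y 2 s = hc x y * (s - 1) := by
  simp [hwPairing]

/-- **Weight line** `s = 1`: the pairing is `hw x y · (k - 2)`, so `d/dk ⟨x,y⟩~(k,1)|_{k=2} = hw x y`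
(Venerucci's notation `d/dk g(k,1)_{k=2} := b` for `g = a{s-1} + b{k-2}`).
[cite: Venerucci2015, §4.3.3 (before Thm. 4.2)] -/
theorem hwPairing_one_right (hc hw : M →+ M →+ R) (x y : M) (k : R) :
    hwPairing hc hw x y k 1 = hw x y * (k - 2) := by
  simp [hwPairing]

/-- **Restriction to a line through `(2,1)`.** Along `k = 2 + u t`, `s = 1 + v t` the pairing is
`t · (v · hc x y + u · hw x y)`: the leading (linear) coefficient along the line of direction
`(u, v)` is the "line pairing" `v · hc + u · hw` (cyclotomic line `(0,1)`, weight line `(1,0)`,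
central critical line `s = k/2`: `u = 2v`). [cite: Venerucci2015, §2.4 (the lines s = 1, s = k/2)] -/
theorem hwPairing_line (hc hw : M →+ M →+ R) (x y : M) (u v t : R) :
    hwPairing hc hw x y (2 + u * t) (1 + v * t) = t * (v * hc x y + u * hw x y) := by
  simp only [hwPairing]
  ring

/-- **The technique class: Venerucci's functional equation** (Thm. 4.2 (3), proved in [Ven]) for a
height–weight pairing of the printed shape: `⟨y,x⟩~(k,s) = -⟨x,y⟩~(k,k-s)` for all `x, y` and all
`(k, s)` — the height-side counterpart of the functional equation
`Λ_p(f_∞,k,s) = -sign(A/ℚ) · Λ_p(f_∞,k,k-s)` of the Mazur–Kitagawa `p`-adic `L`-function, whose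
centre of symmetry is the central critical line `s = k/2`.
[cite: Venerucci2015, §4.3.3 Thm. 4.2 (3)] [cite: Venerucci2015, §2.4 (functional equation, Thm. 5.15 of Greenberg–Stevens)] -/
def HWFunctionalEquation (hc hw : M →+ M →+ R) : Prop :=
  ∀ (x y : M) (k s : R), hwPairing hc hw y x k s = -hwPairing hc hw x y k (k - s)

/-- **The functional equation is equivalent to: `hc` symmetric and `hw + hwᵀ = -hc`.** (`→`:
evaluate at `(k,s) = (2,2)` and `(3,1)`; `←`: expand.) So a pairing of the printed shape satisfies
Theorem 4.2 (3) iff its cyclotomic part is symmetric and its weight part is `-½ hc` plus an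
ALTERNATING pairing; the functional equation constrains nothing else. (Venerucci §6.6: "it
remains to show that `2⟨P,P⟩^wt_p = -⟨P,P⟩^cyc_p`. This follows from Theorem 4.2 (3).")
[cite: Venerucci2015, §6.6 (proof of Thm. E, last lines)] [cite: Venerucci2015, §4.3.3 Thm. 4.2 (3)] -/
theorem hwFunctionalEquation_iff (hc hw : M →+ M →+ R) :
    HWFunctionalEquation hc hw ↔
      (∀ x y, hc x y = hc y x) ∧ (∀ x y, hw x y + hw y x = -hc x y) := by
  constructor
  · intro h
    refine ⟨fun x y => ?_, fun x y => ?_⟩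
    · have e := h x y 2 2
      simp only [hwPairing] at e
      linear_combination -e
    · have e := h x y 3 1
      simp only [hwPairing] at e
      linear_combination e
  · rintro ⟨hs, ha⟩ x y k s
    simp only [hwPairing]
    linear_combination (1 - s) * hs x y + (k - 2) * ha x y

namespace HWFunctionalEquation

variable {hc hw : M →+ M →+ R}

/-- The cyclotomic part of a pairing satisfying the functional equation is symmetric (as the
canonical cyclotomic height is, Nekovář 1993 §7 / Venerucci §4.3.3).
[cite: Venerucci2015, §4.3.3 (symmetric canonical height) and Thm. 4.2 (3)] -/
theorem cyc_symm (h : HWFunctionalEquation hc hw) (x y : M) : hc x y = hc y x :=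
  ((hwFunctionalEquation_iff hc hw).mp h).1 x y

/-- **Antisymmetrisation identity**: `hw x y + hw y x = -hc x y` — the symmetric part of the weight
pairing is minus one half of the cyclotomic pairing. [cite: Venerucci2015, §6.6 (proof of Thm. E)] -/
theorem wt_add_wt (h : HWFunctionalEquation hc hw) (x y : M) : hw x y + hw y x = -hc x y :=
  ((hwFunctionalEquation_iff hc hw).mp h).2 x y

/-- **`2 ⟨x,x⟩^wt = -⟨x,x⟩^cyc`** (Venerucci, proof of Thm. E: "`2⟨P,P⟩^wt_p = -⟨P,P⟩^cyc_p` …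
follows from Theorem 4.2 (3)"). [cite: Venerucci2015, §6.6 (proof of Thm. E)] -/
theorem two_mul_wt_self (h : HWFunctionalEquation hc hw) (x : M) : 2 * hw x x = -hc x x := by
  have e := h.wt_add_wt x x
  linear_combination e

/-- **Skew-symmetry on the central critical line** `2s = k`: `⟨y,x⟩~(k,s) = -⟨x,y⟩~(k,s)`
(Venerucci §6.1: "By the functional equation … `⟨-,-⟩~(k,k/2)` is a skew-symmetric pairing").
[cite: Venerucci2015, §6.1 (before eq. (ccpairing))] -/
theorem central_skew (h : HWFunctionalEquation hc hw) (x y : M) {k s : R} (hks : 2 * s = k) :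
    hwPairing hc hw y x k s = -hwPairing hc hw x y k s := by
  have e := h x y k s
  rwa [show k - s = s by linear_combination -hks] at e

/-- On the central critical line every class pairs to (2-torsion, i.e.) zero with itself:
`2 ⟨x,x⟩~(k,s) = 0` for `2s = k`. [cite: Venerucci2015, §6.1 (skew-symmetry on s = k/2)] -/
theorem two_mul_central_self (h : HWFunctionalEquation hc hw) (x : M) {k s : R} (hks : 2 * s = k) :
    2 * hwPairing hc hw x x k s = 0 := by
  have e := h.central_skew x x hks
  linear_combination e

/-- **Rank one, any line.** For a single class `x` the line pairing along direction `(u, v)`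
satisfies `2 (v · hc x x + u · hw x x) = (2v - u) · hc x x`: it is a fixed multiple of the
cyclotomic height `hc x x`, the multiple `(2v - u)/2` vanishing exactly on the central critical
line `u = 2v`. Weight line `(1,0)`: `2 hw x x = -hc x x` (Thm. E shape); cyclotomic line `(0,1)`:
`hc x x`. [cite: Venerucci2015, §1.2 Thm. E and §6.6] -/
theorem two_mul_line_self (h : HWFunctionalEquation hc hw) (x : M) (u v : R) :
    2 * (v * hc x x + u * hw x x) = (2 * v - u) * hc x x := by
  have e := h.two_mul_wt_self x
  linear_combination u * e

/-- **The extended `2 × 2` determinant on the central critical line.** Suppose, as in Venerucci's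
Thm. 4.2 (2) for the Tate-period class `q = q_A` and a Selmer class `x`, that
`⟨q,x⟩~(k,s) = ℓ · (s - 1)` for all `(k,s)` (there `ℓ = log_A(res_p x)`). Then on the central
critical line `2s = k`:
`4 · (⟨q,q⟩~⟨x,x⟩~ - ⟨q,x⟩~⟨x,q⟩~)(k,s) = ℓ² (k - 2)²` — the extended height-weight restricted to
`s = k/2` is a pure square, `h̃^cc_p(x) = ½ log²_A(res_p(x))` in Venerucci's normalisation
`α ↦ d²/dk² α(k,k/2)|_{k=2}` (eq. (ccpairing)); no height enters.
[cite: Venerucci2015, §6.1 eq. (ccpairing)] [cite: Venerucci2015, §4.3.3 Thm. 4.2 (2)] -/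
theorem extendedDet_central (h : HWFunctionalEquation hc hw) (q x : M) (ℓ : R)
    (hq : ∀ k s, hwPairing hc hw q x k s = ℓ * (s - 1)) {k s : R} (hks : 2 * s = k) :
    4 * (hwPairing hc hw q q k s * hwPairing hc hw x x k s -
        hwPairing hc hw q x k s * hwPairing hc hw x q k s) = ℓ ^ 2 * (k - 2) ^ 2 := by
  have eqq := h.two_mul_central_self q hks
  have exq : hwPairing hc hw x q k s = -(ℓ * (s - 1)) := by
    rw [h.central_skew q x hks, hq k s]
  rw [exq, hq k s]
  linear_combination (2 * hwPairing hc hw x x k s) * eqq + (ℓ ^ 2 * (2 * s + k - 4)) * hks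

end HWFunctionalEquation

/-! ### Gram matrices along a line through `(2, 1)` -/

/-- **Gram matrix of the line pairing** `v · hc + u · hw` on a family `P : ι → M`: the matrix of
leading coefficients of `⟨Pᵢ,Pⱼ⟩~` along the line `k = 2 + u t, s = 1 + v t` (`hwPairing_line`).
Its determinant is the regulator that a leading-term formula along that line would carry
(cyclotomic line `(0,1)`: the Schneider-type regulator `det hc`; weight line `(1,0)`: the weight
regulator `det hw`, cf. Delbourgo's `det ⟨-,-⟩^wt_{F,p}` in the `Γ^wt`-Euler characteristic).
[cite: Venerucci2015, §1.2 (h̃_p as a determinant of ⟨-,-⟩~ values)] [cite: Delbourgo2008, §9.3 and Thm. 9.18] -/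
def lineGram (hc hw : M →+ M →+ R) {ι : Type*} (P : ι → M) (u v : R) : Matrix ι ι R :=
  Matrix.of fun i j => v * hc (P i) (P j) + u * hw (P i) (P j)

/-- Entries of `lineGram`. [folklore] -/
@[simp] theorem lineGram_apply (hc hw : M →+ M →+ R) {ι : Type*} (P : ι → M) (u v : R)
    (i j : ι) : lineGram hc hw P u v i j = v * hc (P i) (P j) + u * hw (P i) (P j) := rfl

namespace HWFunctionalEquation

variable {hc hw : M →+ M →+ R} {ι : Type*}

/-- **Functional equation in matrix form**: `G(u,v)ᵀ = -G(u,u-v)` — transposing the Gram matrix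
along the direction `(u,v)` gives minus the Gram matrix along the reflected direction `(u,u-v)`
(the reflection `s - 1 ↦ (k - 2) - (s - 1)` induced by `s ↦ k - s`; fixed direction: the central
critical line `u = 2v`). [cite: Venerucci2015, §4.3.3 Thm. 4.2 (3)] -/
theorem lineGram_transpose (h : HWFunctionalEquation hc hw) (P : ι → M) (u v : R) :
    (lineGram hc hw P u v).transpose = -lineGram hc hw P u (u - v) := by
  ext i j
  simp only [Matrix.transpose_apply, lineGram_apply, Matrix.neg_apply]
  linear_combination (-v) * h.cyc_symm (P i) (P j) + u * h.wt_add_wt (P i) (P j)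

/-- On the central critical line (`u = 2v`) the Gram matrix is skew: `G(2v,v)ᵀ = -G(2v,v)`.
[cite: Venerucci2015, §6.1 (skew-symmetry on s = k/2)] -/
theorem lineGram_transpose_central (h : HWFunctionalEquation hc hw) (P : ι → M) (v : R) :
    (lineGram hc hw P (2 * v) v).transpose = -lineGram hc hw P (2 * v) v := by
  rw [h.lineGram_transpose, show 2 * v - v = v by ring]

/-- **Rank two, any line: `4 det G(u,v) = (2v - u)² det G(0,1) + u² (hw₀₁ - hw₁₀)²`.** The line
regulator of a pair `P₀, P₁` is the cyclotomic (Schneider-type) regulator `det (hc Pᵢ Pⱼ)` times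
`(v - u/2)²` plus `u²` times the square of the Pfaffian `(hw₀₁ - hw₁₀)/2` of the alternating part
of `hw`. Cyclotomic line `(0,1)`: `det hc`; central line `(2,1)`: Pfaffian² only; weight line
`(1,0)`: `4 det hw = det hc + (hw₀₁ - hw₁₀)²`. No direction is free of both.
[cite: Venerucci2015, §4.3.3 Thm. 4.2 (3)] [cite: Venerucci2015, §6.6 (2⟨P,P⟩^wt = -⟨P,P⟩^cyc)] -/
theorem four_mul_det_lineGram_fin_two (h : HWFunctionalEquation hc hw) (P : Fin 2 → M) (u v : R) :
    4 * (lineGram hc hw P u v).det =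
      (2 * v - u) ^ 2 * (lineGram hc hw P 0 1).det +
        u ^ 2 * (hw (P 0) (P 1) - hw (P 1) (P 0)) ^ 2 := by
  simp only [Matrix.det_fin_two, lineGram_apply]
  have h00 := h.two_mul_wt_self (P 0)
  have h11 := h.two_mul_wt_self (P 1)
  have hs := h.cyc_symm (P 0) (P 1)
  have ha := h.wt_add_wt (P 0) (P 1)
  linear_combination
    ((2 * v - u) * u * hc (P 1) (P 1) + u ^ 2 * (2 * hw (P 1) (P 1) + hc (P 1) (P 1))) * h00 +
      ((2 * v - u) * u * hc (P 0) (P 0)) * h11 +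
      (-2 * (2 * v - u) * u * hc (P 0) (P 1) - u ^ 2 * (hw (P 0) (P 1) + hw (P 1) (P 0) +
        hc (P 0) (P 1)) + 2 * v * u * (hc (P 0) (P 1) - hc (P 1) (P 0))) * ha +
      (2 * v * (2 * v - u) * hc (P 0) (P 1) + 2 * v * u * (hw (P 0) (P 1) - hw (P 1) (P 0)) -
        (2 * v - u) ^ 2 * hc (P 0) (P 1)) * hs

variable [Fintype ι] [DecidableEq ι]

/-- **Reflection law for line regulators**: `det G(u,v) = (-1)^r · det G(u,u-v)`, `r` the size of
the family — the determinant of leading coefficients along a line and along its mirror image in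
the central critical line agree up to the sign `(-1)^r` (from `G(u,v)ᵀ = -G(u,u-v)`), matching
`Λ_p(f_∞,k,s) = -sign(A/ℚ) Λ_p(f_∞,k,k-s)` on the analytic side.
[cite: Venerucci2015, §4.3.3 Thm. 4.2 (3)] [cite: Venerucci2015, §2.4 (functional equation)] -/
theorem det_lineGram_reflect (h : HWFunctionalEquation hc hw) (P : ι → M) (u v : R) :
    (lineGram hc hw P u v).det = (-1) ^ Fintype.card ι * (lineGram hc hw P u (u - v)).det := by
  rw [← Matrix.det_transpose, h.lineGram_transpose, Matrix.det_neg]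

/-- **Central critical line, odd rank: the line regulator is `2`-torsion** (`2 det G(2v,v) = 0`;
over `ℚ_p`, zero): a skew Gram matrix of odd size has vanishing determinant — on `s = k/2` only
Pfaffian-type (even-rank) information survives. With `sign(A/ℚ) = +1` the analytic side vanishes
identically on that line. [cite: Venerucci2015, §6.1 (skew-symmetry on s = k/2)] [cite: Venerucci2015, §2.4 ("when sign(A/Q) = +1, L_p(f_∞,k,k/2) vanishes identically")] -/
theorem two_mul_det_lineGram_central (h : HWFunctionalEquation hc hw) (P : ι → M) (v : R)
    (hodd : Odd (Fintype.card ι)) : 2 * (lineGram hc hw P (2 * v) v).det = 0 := by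
  have e := h.det_lineGram_reflect P (2 * v) v
  rw [show 2 * v - v = v by ring, hodd.neg_one_pow] at e
  linear_combination e

end HWFunctionalEquation

end Algebra

/-! ### The barrier on the tree's objects: weight–height data on `E(ℚ)` -/

section EllipticCurve

variable (W : WeierstrassCurve ℚ) (p : ℕ) [Fact p.Prime]

/-- **Weight–height data on `E(ℚ)`** (hypothesis structure; the technique class at the level of
the tree's objects): a `p`-adic height datum `⟨-,-⟩ = pairing` on `E(ℚ) = W.toAffine.Point` in the
sense of the tree (`PAdicHeightData W p`: symmetric, bi-additive, `ℚ_p`-valued, killing torsion —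
intended: THE canonical cyclotomic height) together with a second bi-additive `ℚ_p`-valued pairing
`wt` (the WEIGHT pairing) such that the two-variable pairing
`⟨P,Q⟩~(k,s) = ⟨P,Q⟩ (s-1) + wt P Q (k-2)` satisfies Venerucci's functional equation
`⟨Q,P⟩~(k,s) = -⟨P,Q⟩~(k,k-s)` (`HWFunctionalEquation pairing wt`). Intended instance: the
restriction to `A(ℚ) ⊗ ℚ_p ⊂ H¹_f(ℚ, V_p A)` (Kummer map) of Nekovář's height–weight pairing of
the self-dual Hida deformation of `T_p A` at an ordinary prime `p`, whose cyclotomic part is the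
canonical cyclotomic height (Thm. 4.2 (1), [Ne] §11) and which satisfies the functional equation
(Thm. 4.2 (3), [Ven]) — printed for `A/ℚ` of conductor `Np`, `p > 3` split multiplicative, `A[p]`
irreducible. As for `PAdicHeightData`, no normalisation is axiomatised (the zero datum is an
instance); the functional equation is the only added axiom.
[cite: Venerucci2015, §4.3.3 Thm. 4.2 (1), (3)] [cite: Nekovar2006, §11 (as cited in Venerucci2015, proof of Thm. 4.2)] -/
structure WeightHeightData extends PAdicHeightData W p where
  /-- The weight pairing `⟨-,-⟩^wt_p : E(ℚ) →+ E(ℚ) →+ ℚ_p`. -/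
  wt : W.toAffine.Point →+ W.toAffine.Point →+ ℚ_[p]
  /-- Venerucci's functional equation `⟨Q,P⟩~(k,s) = -⟨P,Q⟩~(k,k-s)` (Thm. 4.2 (3)). -/
  fe : HWFunctionalEquation pairing wt

namespace WeightHeightData

variable {W p}

/-- **Every cyclotomic datum extends, with alternating part zero.** For any `PAdicHeightData D₀`
the weight pairing `wt := -½ · D₀.pairing` satisfies the functional equation
(`hwFunctionalEquation_iff` with `A = 0`): the technique class `WeightHeightData` is exactly as
(non-)vacuous as the tree's `PAdicHeightData`, and the functional equation alone cannot tell the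
printed weight pairing from `-½⟨-,-⟩^cyc`. [cite: Venerucci2015, §6.6 (2⟨P,P⟩^wt = -⟨P,P⟩^cyc)] -/
def ofPAdicHeightData (D₀ : PAdicHeightData W p) : WeightHeightData W p where
  toPAdicHeightData := D₀
  wt := D₀.pairing.compr₂ (AddMonoidHom.mulLeft (-2⁻¹ : ℚ_[p]))
  fe := by
    rw [hwFunctionalEquation_iff]
    refine ⟨fun P Q => D₀.symm P Q, fun P Q => ?_⟩
    simp only [AddMonoidHom.compr₂_apply, AddMonoidHom.coe_mulLeft]
    rw [D₀.symm Q P]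
    ring

/-- The weight pairing of `ofPAdicHeightData D₀` is `-½ ⟨-,-⟩`. [folklore] -/
@[simp] theorem ofPAdicHeightData_wt (D₀ : PAdicHeightData W p) (P Q : W.toAffine.Point) :
    (ofPAdicHeightData D₀).wt P Q = -2⁻¹ * D₀.pairing P Q := rfl

variable (D : WeightHeightData W p)

/-- `⟨P,Q⟩^wt + ⟨Q,P⟩^wt = -⟨P,Q⟩^cyc` on `E(ℚ)`. [cite: Venerucci2015, §6.6 (proof of Thm. E)] -/
theorem wt_add_wt (P Q : W.toAffine.Point) : D.wt P Q + D.wt Q P = -D.pairing P Q :=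
  D.fe.wt_add_wt P Q

/-- **`2⟨P,P⟩^wt = -⟨P,P⟩^cyc`** on `E(ℚ)` (Venerucci, proof of Thm. E).
[cite: Venerucci2015, §6.6 (proof of Thm. E)] -/
theorem two_mul_wt_self (P : W.toAffine.Point) : 2 * D.wt P P = -D.pairing P P :=
  D.fe.two_mul_wt_self P

/-- **`⟨P,P⟩^wt = -½ ⟨P,P⟩^cyc`**: as quadratic forms on `E(ℚ)` the weight height IS minus one half
of the cyclotomic height (the name of this barrier). [cite: Venerucci2015, §1.2 Thm. E and §6.6] -/
theorem wt_self (P : W.toAffine.Point) : D.wt P P = -2⁻¹ * D.pairing P P := by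
  have e := D.two_mul_wt_self P
  linear_combination (2⁻¹ : ℚ_[p]) * e

/-- The weight pairing kills torsion (values in the torsion-free group `ℚ_p`). [folklore] -/
theorem wt_map_torsion (P Q : W.toAffine.Point) (hP : IsOfFinAddOrder P) : D.wt P Q = 0 := by
  obtain ⟨n, hn, hnP⟩ := hP.exists_nsmul_eq_zero
  have e : (n : ℚ_[p]) * D.wt P Q = 0 := by
    have e1 := map_nsmul (D.wt.flip Q) n P
    rw [hnP, map_zero, AddMonoidHom.flip_apply, nsmul_eq_mul] at e1
    exact e1.symm
  exact (mul_eq_zero.mp e).resolve_left (by exact_mod_cast hn.ne')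

/-- **Rank one, any line**: `2 (v ⟨P,P⟩^cyc + u ⟨P,P⟩^wt) = (2v - u) ⟨P,P⟩^cyc` — along every line
through `(2,1)` the leading coefficient of `⟨P,P⟩~` is `(v - u/2) ⟨P,P⟩^cyc`: zero on the central
critical line `u = 2v` whatever `P`, and on every other line zero iff the cyclotomic height of `P`
vanishes. [cite: Venerucci2015, §1.2 Thm. E, Thm. D and the remark following it] -/
theorem two_mul_line_self (P : W.toAffine.Point) (u v : ℚ_[p]) :
    2 * (v * D.pairing P P + u * D.wt P P) = (2 * v - u) * D.pairing P P :=
  D.fe.two_mul_line_self P u v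

/-- Off the central critical line, the rank-one line coefficient vanishes iff the cyclotomic
height does. [cite: Venerucci2015, §1.2 Thm. E, Thm. D and the remark following it] -/
theorem line_self_eq_zero_iff (P : W.toAffine.Point) {u v : ℚ_[p]} (huv : u ≠ 2 * v) :
    v * D.pairing P P + u * D.wt P P = 0 ↔ D.pairing P P = 0 := by
  have e := D.two_mul_line_self P u v
  have h2 : (2 : ℚ_[p]) ≠ 0 := two_ne_zero
  have hc : (2 * v - u : ℚ_[p]) ≠ 0 := sub_ne_zero.mpr (Ne.symm huv)
  constructor
  · intro h0
    rw [h0, mul_zero] at e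
    exact (mul_eq_zero.mp e.symm).resolve_left hc
  · intro h0
    have : 2 * (v * D.pairing P P + u * D.wt P P) = 0 := by rw [e, h0, mul_zero]
    exact (mul_eq_zero.mp this).resolve_left h2

/-- The cyclotomic-line Gram matrix `G(0,1)` is the tree's `p`-adic height pairing matrix of the
underlying `PAdicHeightData` (so `det G(0,1)` is `padicRegulatorOf D.toPAdicHeightData P`, the
Schneider-type regulator, by `rfl` up to the decidability instance). [cite: MazurSteinTate2006, §1 Conj. 1.1] -/
theorem lineGram_zero_one {ι : Type*} (P : ι → W.toAffine.Point) :
    lineGram D.pairing D.wt P 0 1 = D.toPAdicHeightData.pairingMatrix P := by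
  ext i j
  simp [lineGram, PAdicHeightData.pairingMatrix]

/-- The weight-line Gram matrix `G(1,0)` is the weight pairing matrix `(⟨Pᵢ,Pⱼ⟩^wt)`, whose
determinant is a weight regulator of the shape `det ⟨-,-⟩^wt`. [cite: Delbourgo2008, §9.3 and Thm. 9.18] -/
theorem lineGram_one_zero {ι : Type*} (P : ι → W.toAffine.Point) :
    lineGram D.pairing D.wt P 1 0 = Matrix.of fun i j => D.wt (P i) (P j) := by
  ext i j
  simp [lineGram]

/-- **Reflection law** on `E(ℚ)`: `det G(u,v) = (-1)^r det G(u,u-v)` for every finite family.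
[cite: Venerucci2015, §4.3.3 Thm. 4.2 (3)] -/
theorem det_lineGram_reflect {ι : Type*} [Fintype ι] [DecidableEq ι] (P : ι → W.toAffine.Point)
    (u v : ℚ_[p]) :
    (lineGram D.pairing D.wt P u v).det =
      (-1) ^ Fintype.card ι * (lineGram D.pairing D.wt P u (u - v)).det :=
  D.fe.det_lineGram_reflect P u v

/-- **Central critical line, odd rank**: the line regulator vanishes (over `ℚ_p`, `2 ≠ 0`).
[cite: Venerucci2015, §6.1 (skew-symmetry on s = k/2)] -/
theorem det_lineGram_central_eq_zero {ι : Type*} [Fintype ι] [DecidableEq ι]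
    (P : ι → W.toAffine.Point) (v : ℚ_[p]) (hodd : Odd (Fintype.card ι)) :
    (lineGram D.pairing D.wt P (2 * v) v).det = 0 := by
  have e := D.fe.two_mul_det_lineGram_central P v hodd
  exact (mul_eq_zero.mp e).resolve_left two_ne_zero

/-- **Rank one, weight line versus cyclotomic line**: for a one-element family,
`2 det G(1,0) = -det G(0,1)` — the weight regulator is `-½` the Schneider-type regulator, so
"exact order on the weight line" and "exact order on the cyclotomic line" are the SAME
non-vanishing in rank one. [cite: Venerucci2015, §1.2 Thm. E] -/
theorem two_mul_det_lineGram_fin_one (P : Fin 1 → W.toAffine.Point) :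
    2 * (lineGram D.pairing D.wt P 1 0).det = -(lineGram D.pairing D.wt P 0 1).det := by
  simp only [Matrix.det_fin_one, lineGram_apply, one_mul, zero_mul, zero_add, add_zero]
  exact D.two_mul_wt_self (P 0)

/-- **Rank two, any line** on `E(ℚ)`: `4 det G(u,v) = (2v - u)² det G(0,1) + u² (wt₀₁ - wt₁₀)²`.
[cite: Venerucci2015, §4.3.3 Thm. 4.2 (3)] -/
theorem four_mul_det_lineGram_fin_two (P : Fin 2 → W.toAffine.Point) (u v : ℚ_[p]) :
    4 * (lineGram D.pairing D.wt P u v).det =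
      (2 * v - u) ^ 2 * (lineGram D.pairing D.wt P 0 1).det +
        u ^ 2 * (D.wt (P 0) (P 1) - D.wt (P 1) (P 0)) ^ 2 :=
  D.fe.four_mul_det_lineGram_fin_two P u v

end WeightHeightData

/-! ### The barrier statement -/

/-- **Barrier (named statement, PROVED below): the weight height is minus one half of the
cyclotomic height; every line through `(2,1)` sees the rank through the same heights.** For every
Weierstrass model `W/ℚ`, prime `p` and every weight–height datum `D` on `E(ℚ)`
(`WeightHeightData W p`: a cyclotomic `p`-adic height datum plus a weight pairing subject to
Venerucci's functional equation `⟨Q,P⟩~(k,s) = -⟨P,Q⟩~(k,k-s)`): (1) `⟨P,Q⟩^wt + ⟨Q,P⟩^wt =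
-⟨P,Q⟩^cyc` (the weight pairing is `-½⟨-,-⟩^cyc` plus an alternating pairing); (2) `2⟨P,P⟩^wt =
-⟨P,P⟩^cyc` ("weight height `= -½` cyclotomic height"; Venerucci Thm. E / §6.6); (3) rank one,
any line of direction `(u,v)`: `2 (v⟨P,P⟩^cyc + u⟨P,P⟩^wt) = (2v - u)⟨P,P⟩^cyc` — zero on the
central critical line `u = 2v`, and otherwise zero iff `⟨P,P⟩^cyc = 0`; (4) any finite family,
reflection law `det G(u,v) = (-1)^r det G(u,u-v)` for the Gram matrix `G(u,v) = (v⟨Pᵢ,Pⱼ⟩^cyc +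
u⟨Pᵢ,Pⱼ⟩^wt)` of leading coefficients along the line; (5) rank two, any line:
`4 det G(u,v) = (2v - u)² det(⟨Pᵢ,Pⱼ⟩^cyc) + u² (⟨P₀,P₁⟩^wt - ⟨P₁,P₀⟩^wt)²`.

BARRIER (D-0021), one line per key:
* technique_class: second-p-adic-variable hida-family two-variable-p-adic-l-function weight-line central-critical-line slanted-line height-weight-pairing — formally `HWFunctionalEquation hc hw` (pairings `hc x y (s-1) + hw x y (k-2)` with `⟨y,x⟩~(k,s) = -⟨x,y⟩~(k,k-s)` [cite: Venerucci2015, §4.3.3 Thm. 4.2 (3)]) and, on the tree's objects, `WeightHeightData W p` (a `PAdicHeightData W p` plus a weight pairing with that functional equation); every order-of-vanishing / leading-term statement for `L_p(f_∞;k,s)` along a line through `(2,1)`, or for its `2`-jet, whose algebraic side is a Gram determinant of Nekovář's height–weight pairing (two-variable `p`-adic Gross–Zagier / BSD shape `L_p(f_∞,k,s) mod 𝒥³ = ℓ₂ · h̃_p(P)` [cite: Venerucci2015, §1.2 Thm. C]).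
* blocks: by (2)–(3), in rank one the leading coefficient of `⟨P,P⟩~` along EVERY line other than the central critical one is a non-zero rational multiple of `⟨P,P⟩^cyc_p` — the weight line carries `⟨P,P⟩^wt_p = -½⟨P,P⟩^cyc_p`, and analytically `-ℓ₄ · ⟨P,P⟩^cyc_p = d/dk L_p^*(f_∞,k)_{k=2} = 2ℓ₄ · ⟨P,P⟩^wt_p` [cite: Venerucci2015, §1.2 Thm. E], so "`ord_{k=2} L_p^*(f_∞,k) = 1` in analytic rank one" is the non-vanishing of the canonical cyclotomic height of `P`, exactly as "`ord_{s=1} L_p(A/ℚ,s) = 2`" on the cyclotomic line is `⟨P,P⟩^Sch_p ≠ 0`, which loc. cit. records as unsettled [cite: Venerucci2015, §1.2 Thm. D and the remark following it]; a weight-variable BSD leading term is `∝ det ⟨-,-⟩^wt` and its exact order `= rank` is stated only under non-degeneracy of the weight pairing (`≥ rank + 1` if degenerate) [cite: Delbourgo2008, Thm. 9.18]; by (4)–(5) in rank `r ≥ 2` the line regulator is `det((v - u/2) H_cyc + u A)` with `A` alternating — `(v - u/2)^r det H_cyc +` Pfaffian-type terms (rank two: `(2v-u)² det H_cyc + u²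 (wt₀₁ - wt₁₀)²`, times `¼`) — so no line and no jet coefficient is free of a non-degeneracy statement about `H_cyc` (Schneider-type non-degeneracy, the hypothesis catalogued under `PAdicHeightBarrier`) or about the alternating part; on the central critical line the symmetric part drops out entirely ((3) with `u = 2v`; odd rank: `det = 0`, `det_lineGram_central_eq_zero`), and analytically `L_p(f_∞,k,k/2) ≡ 0` when `sign(A/ℚ) = +1` [cite: Venerucci2015, §2.4 (functional equation)]. Named: the lens-3 candidate "weight-line order `ord_{k=2} L_p(f_∞;k,1) ≤ r_an`" (item `stmt-BirchSwinnertonDyer-0489`) inherits the cyclotomic-height hypothesis of route `PAdicOrder` (`PAdicOrderComparisonR2`) through (2).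
* because: the functional equation `⟨y,x⟩~(k,s) = -⟨x,y⟩~(k,k-s)` [cite: Venerucci2015, §4.3.3 Thm. 4.2 (3)] is EQUIVALENT to "`⟨-,-⟩^cyc` symmetric and `⟨x,y⟩^wt + ⟨y,x⟩^wt = -⟨x,y⟩^cyc`" (`hwFunctionalEquation_iff`: evaluate at `(k,s) = (2,2), (3,1)`), whence `2⟨P,P⟩^wt = -⟨P,P⟩^cyc` ("This follows from Theorem 4.2 (3)") [cite: Venerucci2015, §6.6 (proof of Thm. E)] and skew-symmetry of `⟨-,-⟩~(k,k/2)` [cite: Venerucci2015, §6.1]; the cyclotomic part is the canonical cyclotomic height, `d/ds ⟨x,y⟩~(2,s)_{s=1} = ⟨x,y⟩^cyc_p` [cite: Venerucci2015, §4.3.3 Thm. 4.2 (1)] [cite: Nekovar2006, §11 (as cited in Venerucci2015, proof of Thm. 4.2)]; in matrix form `G(u,v)ᵀ = -G(u,u-v)` (`lineGram_transpose`), so `det G(u,v) = (-1)^r det G(u,u-v)` (`det_lineGram_reflect`) and the rank-two expansion (`four_mul_det_lineGram_fin_two`); analytically the same symmetry `Λ_p(f_∞,k,s) = -sign(A/ℚ)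 Λ_p(f_∞,k,k-s)` with centre `s = k/2` [cite: Venerucci2015, §2.4 (Thm. 5.15 of Greenberg–Stevens)] [cite: GreenbergStevens1993, Thm. 5.15 (as cited in Venerucci2015 §2.4)].
* evasions_known: none height-free in rank `≥ 2` in the sources read; in rank ONE at a split multiplicative prime: (i) the TOTAL `2`-jet — `L_p(f_∞,k,s) mod 𝒥³ = ℓ₂ · h̃_p(P)` and `L_p(f_∞,k,s) ∈ 𝒥³ ↔ P = 0` [cite: Venerucci2015, §1.2 Thm. C], the extended determinant `h̃_p(P)` involving the height-free entries `⟨q_A,q_A⟩~ = log_p(q_A){s-k/2}`, `⟨q_A,P⟩~ = log_A(res_p P){s-1}` [cite: Venerucci2015, §4.3.3 Thm. 4.2 (2)], and the proof reading `P ≠ 0` off the central critical line through the Bertolini–Darmon formula [cite: Venerucci2015, §6.4.2–6.4.3 (Steps II–III)]; (ii) the central critical line, where the extended height-weight is a pure square, `h̃^cc_p(x) = ½ log²_A(res_p x)` (`extendedDet_central`) [cite: Venerucci2015, §6.1 eq. (ccpairing)] and `d²/dk² L_p^cc(f_∞,k)_{k=2} = ℓ · log²_A(P)`, `P ≠ 0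 ↔ ord_{s=1} L(A/ℚ,s) = 1` [cite: Venerucci2015, §2.5 Thm. 2.1 (Bertolini–Darmon)] [cite: BertoliniDarmon2007, main theorem (as restated in Venerucci2015 Thm. 2.1)]; (iii) the alternating part `A` of `⟨-,-⟩^wt` is unconstrained by the functional equation (`hwFunctionalEquation_iff`), so even-rank Pfaffian information on the central line is not excluded by anything proved here; (iv) the rank-one evasions of the one-variable entries (supersingular `p`, critical-slope pair `h_α/h_β`, BDP) listed under `PAdicHeightBarrierNarrow` apply unchanged, being statements about `⟨-,-⟩^cyc`.
* scope_caveats: (a) what is PROVED is bilinear algebra: conjuncts (1)–(5) hold for ANY `ℚ_p`-valued (in the abstract section: any commutative-ring-valued) pair of bi-additive pairings satisfying the functional equation, on any abelian group; that Nekovář's height–weight pairing exists, has the canonical cyclotomic height as cyclotomic part and satisfies the functional equation is Venerucci's Thm. 4.2 (1), (3), entering as the AXIOM `fe` (and the choice of `pairing`) of the hypothesis structure `WeightHeightData` — no two-variable height, Hida family or Selmer complex is constructed in the tree, and the zero datum is an instance; (b) Thm. 4.2 is PRINTED for `A/ℚ` of conductor `Np` with `p > 3` of SPLIT MULTIPLICATIVE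 reduction and `A[p]` irreducible, on Nekovář's extended Selmer group `H̃¹_f = ℚ_p · q_A ⊕ H¹_f` [cite: Venerucci2015, §1 (standing hypotheses) and §4.2], with proofs deferred to [Ne] (part 1) and to the companion preprint [Ven] (parts 2, 3) [cite: Venerucci2015, §4.3.3 (proof of Thm. 4.2)]; neither Nekovář's Astérisque 310 nor [Ven] nor Bertolini–Darmon 2007 was read for this entry (not held; acq-06293), so the GOOD ORDINARY case — Nekovář's general formalism for self-dual Hida deformations — is covered here only by citation, and supersingular `p` / Coleman families / non-self-dual twists not at all; (c) the structure restricts the pairing to `E(ℚ)` (Mordell–Weil points via Kummer), whereas the printed pairing lives on `H̃¹_f(ℚ, V_p A)`; the Tate-period class `q_A` and Thm. 4.2 (2) appear only as the hypothesis `hq` of `extendedDet_central`; (d) the link "leading form of `L_p(f_∞;k,s)` at `(2,1)` `=` determinant of `⟨-,-⟩~`" is a THEOREM in analytic rank one at split multiplicative `p` (Thms. C, D, E) and otherwise only the expected two-variable BSD shape [cite: Venerucci2015, §1.2 (the Mazur–Tate–Teitelbaum prediction: leading term = extended Mordell–Weil determinant)] — nothing analytic is formalised here, and Delbourgo's weight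 pairing `⟨-,-⟩^wt_{F,p}` (bi-extensions, Def. 9.10) is not identified with Nekovář's `⟨-,-⟩^wt_p` in the sources read [cite: Delbourgo2008, §9.3 Def. 9.10]; (e) the entry is an EQUIVALENCE of hypotheses (weight-line / slanted-line exactness ⟺ cyclotomic-height non-vanishing in rank one), not an impossibility theorem: a proof of the non-degeneracy of the canonical cyclotomic height [cite: MazurSteinTate2006, §1 Conj. 1.1], or curve-by-curve certification of `⟨P,P⟩^cyc_p ≠ 0`, dissolves it exactly as for `PAdicHeightBarrier`.
* status: established (theorem `weightHeightMinusHalfCyclotomic_holds`, proved in this file from `hwFunctionalEquation_iff`, `HWFunctionalEquation.det_lineGram_reflect`, `HWFunctionalEquation.four_mul_det_lineGram_fin_two`; the instantiation is Venerucci 2016 Thm. 4.2 (1), (3) [cite: Venerucci2015, §4.3.3 Thm. 4.2])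

[cite: Venerucci2015, §4.3.3 Thm. 4.2 (3) and §6.6 (proof of Thm. E)] [cite: Venerucci2015, §1.2 Thm. E] -/
def WeightHeightMinusHalfCyclotomic : Prop :=
  ∀ (W : WeierstrassCurve ℚ) (p : ℕ) [Fact p.Prime] (D : WeightHeightData W p),
    (∀ P Q : W.toAffine.Point, D.wt P Q + D.wt Q P = -D.pairing P Q) ∧
    (∀ P : W.toAffine.Point, 2 * D.wt P P = -D.pairing P P) ∧
    (∀ (P : W.toAffine.Point) (u v : ℚ_[p]),
        2 * (v * D.pairing P P + u * D.wt P P) = (2 * v - u) * D.pairing P P) ∧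
    (∀ (ι : Type) [Fintype ι] [DecidableEq ι] (P : ι → W.toAffine.Point) (u v : ℚ_[p]),
        (lineGram D.pairing D.wt P u v).det =
          (-1) ^ Fintype.card ι * (lineGram D.pairing D.wt P u (u - v)).det) ∧
    (∀ (P : Fin 2 → W.toAffine.Point) (u v : ℚ_[p]),
        4 * (lineGram D.pairing D.wt P u v).det =
          (2 * v - u) ^ 2 * (lineGram D.pairing D.wt P 0 1).det +
            u ^ 2 * (D.wt (P 0) (P 1) - D.wt (P 1) (P 0)) ^ 2)

/-- **`WeightHeightMinusHalfCyclotomic` holds** (from `WeightHeightData.wt_add_wt`,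
`two_mul_wt_self`, `two_mul_line_self`, `det_lineGram_reflect`, `four_mul_det_lineGram_fin_two`,
all consequences of the functional-equation axiom `fe`).
[cite: Venerucci2015, §4.3.3 Thm. 4.2 (3) and §6.6] -/
theorem weightHeightMinusHalfCyclotomic_holds : WeightHeightMinusHalfCyclotomic :=
  fun _W _p _ D =>
    ⟨D.wt_add_wt, D.two_mul_wt_self, D.two_mul_line_self,
      fun _ι _ _ P u v => D.det_lineGram_reflect P u v,
      fun P u v => D.four_mul_det_lineGram_fin_two P u v⟩

end EllipticCurve

end Literature.Barriers.BirchSwinnertonDyer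

end
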